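import Literature.Probability.Percolation.CornerPercolation
import HarnessLib

/-!
# The eventual-in-`n` clause of `BoxCrossingBounds` on `√2 ℤ²` cannot start below `n₀ = 2`
(negative-side support for crux `UniformBoxCrossing`, stmt-CriticalPhenomena-5476, route
`CardySelfDualSegment`; cdisprove seat, cycle 1)

`UniformBoxCrossing` asks for `BoxCrossingBounds (cornerPercolation t) squareLatticeEmbedding.z ρ c n₀`
with `c, n₀` uniform in `t`. Tightness of the eventual clause: for EVERY measure `μ` on bond
configurations of `ℤ²`, every aspect ratio `ρ` and every `c > 0`, the bounds fail if `n₀ ≤ 1`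
(`boxCrossingBounds_square_false_of_le_one`): at scale `n = 1` the translate `w = -(11/10) i` of
the unit-height strip `ℝ × [0, 1]` contains no vertex of `√2 ℤ²` (`im_translate_not_mem_Icc`), so
the slack-2 horizontal crossing event of `w + [0, ρ] × [0, 1]` is empty and has probability
`0 < c`. Hence every witness `(c, n₀)` of the crux has `n₀ ≥ 2` (`two_le_of_boxCrossingBounds`):
harmless for provers (choose `n₀ ≥ 2`, as `IsoradialProofs.square_embRectCrossing_bounds` does),
fatal for any restatement "for all `n ≥ 1`". Elementary; [folklore].
-/

namespace Summit.CriticalPhenomena.CardyFormulaZ2.Theorems.UniformBoxCrossing.Negative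

open MeasureTheory Literature.Probability.Percolation Literature.Probability.LatticeModels

noncomputable section

/-- `7/5 < √2`. -/
theorem seven_fifths_lt_sqrt_two : (7 / 5 : ℝ) < Real.sqrt 2 := by
  rw [show (7 / 5 : ℝ) = Real.sqrt ((7 / 5) ^ 2) by rw [Real.sqrt_sq (by norm_num)]]
  exact Real.sqrt_lt_sqrt (by norm_num) (by norm_num)

/-- No vertex of `√2 ℤ² + (11/10) i` has ordinate in `[0, 1]`. -/
theorem im_translate_not_mem_Icc (v : Site 2) :
    (squareLatticeEmbedding.z v - (-(11 / 10 : ℝ) * Complex.I)).im ∉ Set.Icc (0 : ℝ) 1 := by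
  have hz : (squareLatticeEmbedding.z v - (-(11 / 10 : ℝ) * Complex.I)).im =
      Real.sqrt 2 * (v 1 : ℝ) + 11 / 10 := by
    simp [squareLatticeEmbedding, Site.toComplex]
  rw [hz]
  rintro ⟨h0, h1⟩
  have hs := seven_fifths_lt_sqrt_two
  rcases le_or_gt 0 (v 1) with hv | hv
  · have : (0 : ℝ) ≤ (v 1 : ℝ) := by exact_mod_cast hv
    nlinarith
  · have hv' : v 1 ≤ -1 := by omega
    have : (v 1 : ℝ) ≤ -1 := by exact_mod_cast hv'
    nlinarith

/-- **Tightness of `n₀`.** For every measure `μ` on bond configurations of `ℤ²`, every aspect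
ratio `ρ` and every `c > 0`, the box-crossing bounds on `√2 ℤ²` FAIL if the eventual clause starts
at `n₀ ≤ 1`: at scale `n = 1` the strip `w + ℝ × [0, 1]`, `w = -(11/10) i`, contains no vertex, so
the horizontal crossing event of `w + [0, ρ] × [0, 1]` is empty and has probability `0 < c`. -/
theorem boxCrossingBounds_square_false_of_le_one (μ : Measure (BondConfig (Site 2))) {ρ c : ℝ}
    (hc : 0 < c) {n₀ : ℕ} (hn₀ : n₀ ≤ 1) :
    ¬ BoxCrossingBounds μ squareLatticeEmbedding.z ρ c n₀ := by
  intro h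
  have h1 := (h 1 hn₀ (-(11 / 10 : ℝ) * Complex.I)).1.1
  have hempty : embRectCrossing (fun v => squareLatticeEmbedding.z v - (-(11 / 10 : ℝ) * Complex.I))
      (ρ * (1 : ℕ)) (1 : ℕ) = ∅ := by
    ext ω
    simp only [embRectCrossing, mem_openCrossing_iff, Set.mem_setOf_eq, Set.mem_empty_iff_false,
      iff_false, not_exists, not_and]
    intro x _ y _ hω
    obtain ⟨hx, _, _⟩ := hω
    exact im_translate_not_mem_Icc x (by simpa using hx.2)
  rw [hempty, measureReal_empty] at h1
  exact absurd h1 (not_le.2 hc)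

/-- Corollary: every witness `(c, n₀)` of box-crossing bounds on `√2 ℤ²` (in particular of the
crux `UniformBoxCrossing`, at any aspect ratio and any `t`) has `n₀ ≥ 2`. -/
theorem two_le_of_boxCrossingBounds (μ : Measure (BondConfig (Site 2))) {ρ c : ℝ} (hc : 0 < c)
    {n₀ : ℕ} (h : BoxCrossingBounds μ squareLatticeEmbedding.z ρ c n₀) : 2 ≤ n₀ := by
  by_contra hlt
  exact boxCrossingBounds_square_false_of_le_one μ hc (by omega) h

end

end Summit.CriticalPhenomena.CardyFormulaZ2.Theorems.UniformBoxCrossing.Negative
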